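import Mathlib
import Summits.AtomisticToContinuum.FouriersLaw.Theorems.EmbeddedDrudeMourreMourreDissolutionFibreTwoZeroFloor
import Summits.AtomisticToContinuum.FouriersLaw.Theorems.EmbeddedDrudeMourreMourreDissolutionPlaneTransversal
import Summits.AtomisticToContinuum.FouriersLaw.Theorems.EmbeddedDrudeMourreMourreDissolutionJacobianFloor
import Summits.AtomisticToContinuum.FouriersLaw.Theorems.EmbeddedDrudeMourreMourreDissolutionFormFiniteSmooth
import Summits.AtomisticToContinuum.FouriersLaw.Theorems.EmbeddedDrudeMourreMourreDissolutionFibreDomination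
import Summits.AtomisticToContinuum.FouriersLaw.Theorems.EmbeddedDrudeMourreMourreDissolutionThresholdFGR
import HarnessLib

/-!
# `MourreDissolution`, line `swap-odd-threshold-rigidity`: FERMI'S GOLDEN RULE AT THE THRESHOLD

Support file (crux item `stmt-AtomisticToContinuum-12594`, route `EmbeddedDrudeMourre`, sub-problem
`FouriersLaw`; lead c8). The unconditional corollaries of the line's stubs I1, GL, BM, FIN, TA, TB, TZ,
DOM, LIM (all theorems of the tree):

* `boltzmannForm_lt_top_of_contDiff_two` — every `2π`-periodic `C²` profile lies in the form domain of
  ALS's linearised phonon collision operator of the pinned chain: `q_{ω₂,a,b}(f) < ∞` (`ω₂ > 0`).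
* `fermiGoldenRule_threshold` — the Poisson-regularised, bracket-weighted two-phonon spectral function
  `R_f(ν, 0) = ∫∫∫_{cell³} Φ²(∏ω)⁻²[f]²·ν/(Ω² + ν²)` (the free second-order level shift of the
  one-phonon charge with profile `f`, up to thermal constants) converges as `ν ↓ 0` to
  `(4π/alsPrefactor)·q(f)`: at the threshold frequency `0`, Fermi's golden rule IS the Boltzmann
  collision form (Aoki–Lukkarinen–Spohn's (3.17)–(3.20) ↔ (4.1), (4.10)–(4.11), made a theorem).

References: K. Aoki, J. Lukkarinen, H. Spohn, J. Stat. Phys. 124 (2006), §3 (3.17)–(3.20), §4 (4.1),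
(4.10)–(4.11), (4.16); J. Lukkarinen, LNP 921 (2016), §3.4.
-/

noncomputable section

open MeasureTheory Set Real Filter Topology
open scoped ENNReal

namespace Summit.AtomisticToContinuum.FouriersLaw.Theorems.MourreDissolution

open Literature.MathematicalPhysics.KineticTheory.PhononBoltzmann

/-- **Smooth profiles are in the form domain**: for `ω₂ > 0`, any couplings `a, b` and every
`2π`-periodic `C²` profile `f`, ALS's Boltzmann form is finite, `q_{ω₂,a,b}(f) < ∞` (Jacobian floor GL
from the global factorisation I1, bracket modulus BM, twelve resonant candidates).
[cite: AokiLukkarinenSpohn2006, §4 after eq. (4.16)] -/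
theorem boltzmannForm_lt_top_of_contDiff_two :
    ∀ ω₂ a b : ℝ, 0 < ω₂ → ∀ f : ℝ → ℝ, Function.Periodic f (2 * Real.pi) → ContDiff ℝ 2 f →
      boltzmannForm ω₂ a b f < ⊤ :=
  stub_formFiniteSmooth (stub_jacobianFloor stub_resonanceFactorisation) stub_bracketModulus

/-- **Fermi's golden rule at the threshold = the Boltzmann collision form.** For `ω₂ > 0`, couplings
`a, b` and a `2π`-periodic `C²` profile `f`, the Poisson-regularised bracket-weighted two-phonon spectral
function at frequency `0` converges, as `ν ↓ 0`, to `(4π/alsPrefactor)·q_{ω₂,a,b}(f)` (dominated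
convergence over the `k₂`-fibres: fibre dictionary, uniform two-zero floor TZ of the resonance function,
fibre domination). [cite: AokiLukkarinenSpohn2006, eqs. (3.17)-(3.20), (4.1), (4.10)-(4.11)] -/
theorem fermiGoldenRule_threshold :
    ∀ ω₂ a b : ℝ, 0 < ω₂ → ∀ f : ℝ → ℝ, Function.Periodic f (2 * Real.pi) → ContDiff ℝ 2 f →
      Tendsto
        (fun ν : ℝ => ∫ k₁ in Set.Ioc (-Real.pi) Real.pi, ∫ k₃ in Set.Ioc (-Real.pi) Real.pi,
          ∫ k₂ in Set.Ioc (-Real.pi) Real.pi,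
            vertex a b k₁ k₂ k₃ ^ 2 /
                (dispersion ω₂ k₁ * dispersion ω₂ k₂ * dispersion ω₂ k₃ * dispersion ω₂ (k₁ + k₂ - k₃)) ^ 2 *
              (f k₁ + f k₂ - f k₃ - f (k₁ + k₂ - k₃)) ^ 2 *
              (ν / (resonanceFn ω₂ k₁ k₂ k₃ ^ 2 + ν ^ 2)))
        (𝓝[>] (0 : ℝ)) (𝓝 (4 * Real.pi / alsPrefactor * (boltzmannForm ω₂ a b f).toReal)) :=
  fun ω₂ a b hω f hper hf =>
    stub_thresholdFGR_of
      (stub_fibreDomination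
        (stub_fibreTwoZeroFloor (stub_sheetTransversal stub_resonanceFactorisation
          (stub_jacobianFloor stub_resonanceFactorisation)) stub_planeTransversal)
        stub_bracketModulus)
      ω₂ a b hω f hper hf (boltzmannForm_lt_top_of_contDiff_two ω₂ a b hω f hper hf)

end Summit.AtomisticToContinuum.FouriersLaw.Theorems.MourreDissolution

end
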